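import Mathlib.Analysis.Calculus.Deriv.MeanValue
import Summits.HubbardSuperconductivity.HubbardSuperconductivity.Theorems.WeakCouplingBCSKlVertexPropagation
import Summits.HubbardSuperconductivity.HubbardSuperconductivity.Theorems.WeakCouplingBCSKlPinchOrder

/-!
# The «signed-drift leaf»: `B1g` dominance on a whole segment from ONE certified vertex cell (KL-MARGIN-SCAN HQ1 (ii)/(iii), control reading)

Reader seat hubbard-klscan-idea-2 (lens: control — a monotone / one-sided functional of the certified margins), round 8; bears on the
certificate half of `Theses.WeakCouplingBCS.WcbcsKohnLuttingerB1g` (stmt-HubbardSuperconductivity-0158) and on the director's HQ1 (ii)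
«monotone in `δ` at `t′ = 0`» / (iii) «single sign crossing along `t′` at `δ = ⅛`».  HONEST FRAMING: a Kohn–Luttinger `O(U²)` channel
statement is not ODLRO and nothing here proves superconductivity in the Hubbard model; NO margin at any `t′ ≠ 0` is asserted; nothing is
said about `K₃`, `U₀` or the onset window; the file contains NO numerical record (the floats quoted in docstrings are the card's motivation,
never hypotheses).  It fixes the SHAPE of a ONE-VERTEX segment certificate and PROVES its soundness from order theory and the mean value theorem.

THE CONTROL READING.  First-order transport of a certified cell along `t′` is dead IN NORM (`KlVertexPropagation`, module docstring: the
folded kernel moves by `0.2–0.4` in operator norm per `0.02` of `t′` on the `δ = ⅛` line, a `0.24` margin is spent after `|Δt′| ≈ 0.015`) but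
— this is the observation of the card — alive IN SIGN.  On the common chart of a segment (`KLChartedLine`: one reference state space for all
`t′`, pulled-back forms `q_{t′} χ`), split the job by the sign each side of the margin can use:
* RIVAL FLOORS move only by the NEGATIVE PART of the increment: `inf q_{t′} χ ≥ inf q_s χ − D_χ(t′)` as soon as `q_s χ ψ − D_χ(t′) ≤ q_{t′} χ ψ`
  on the rival reference states (`sInf_image_sub_le_of_drift`; for matrices Weyl's lower inequality `λ_min(A + B) ≥ λ_min(A) + λ_min(B)`,
  Horn–Johnson Thm 4.3.1 (4.3.2b), here `le_sInf_image_add`) — the positive part of the increment, however large, costs nothing;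
* the `B1g` CEILING is one explicit TRANSPORTED Ritz state per point (`∃ ψ ∈ S B1g, q_{t′} B1g ψ ≤ C(t′)`), whose attraction GROWS towards the
  van Hove level — growth is pure gain, no eigen-information is needed on the `B1g` side at all;
so the margin at `t′` is at least `F − D(t′) − C(t′)` with `F` the vertex rival floors: ONE certified vertex cell `s` plus two ONE-SIDED
continuum budgets certify the whole segment (`klB1gDominatesOnLine_of_signedDrift`).  In derivative form (the engine's natural currency:
`∂_{t′} q ≤ ω_χ` on rival states, `∂_{t′} q ψ₀ ≥ a` on the test state) the budgets are LINEAR in `t′` and the whole segment condition reduces to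
TWO scalar checks at the segment's ends (`klB1gDominatesOnLine_of_derivBudget_right/left`, mean value theorem).  Floats (`δ = ⅛`, polar chart,
raw gauge, `M = 128` Galerkin, `n_s = 36`, `N = 192`): from the `t′ = 0` vertex ALONE (a TREE cell) the signed minorant retains `98 → 79 %` of the
true margin on the whole `Γ` segment `t′ ∈ [−0.12, 0]` (`0.264 → 0.437`, increasing; normed transport: `+0.008` at `−0.02`, negative beyond),
from the `t′ = −0.3` vertex alone `98 → 67 %` (`79 %` over the rivals proper `A2g, B2g, E`) on the `M` segment `[−0.30, −0.18]`; the stepwise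
derivative budget `a − max_χ ω_χ` is POSITIVE on every `0.02`-step of both segments (`+0.46 … +3.99` per unit `t′`), and on the `t′ = 0` doping
axis from the far vertex `δ = 0.35` (margin `0.038`) down to `δ = 0.05` (`+0.085 … +1.91` per unit `μ`; `85 → 63 %` retained over the whole
window of record).  The DOS gauge, which the chord reading needs, is the WRONG gauge here (retention `50 %` / failure at the `M` end): one-sided
transport wants the raw forms.  Lineage inside this seat: the value-level rival drift `KlPinchOrder.RivalDrift` (round 4) is the shadow of the
chart drift (`rivalDrift_of_chartDrift`); the cone order of `KlConeOrder` (round 7) is the eigenvector-free form of the transported Ritz step on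
the `B1g` side; new here is their signed ASSEMBLY on idea-3's chart, from ONE vertex, along `t′`, and the monotone-minorant reading of HQ1 (ii).

* §1 abstract one-sided transport of infima of images (`sInf_image_sub_le_of_drift`, `le_sInf_image_add`, `sInf_image_sub_le_of_increment`).
* §2 the one-vertex segment theorem on a `KLChartedLine` (`klB1gDominatesOnLine_of_signedDrift`) ⇒ `KLB1gDominatesOnLineTP δ t₁ t₂ (G·γ)`;
  consumers: `KlVertexPropagation.SegmentRow_d0125_G` from the `t′ = 0` vertex, `SegmentRow_d0125_M` from the `t′ = −3/10` vertex.
* §3 the derivative (mean-value) form with linear budgets and two endpoint checks (`…_of_derivBudget_right`, `…_of_derivBudget_left`).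
* §4 the `t′ = 0` doping axis: the charted window `KLChartedAxis a b` (hypothesis-carrying, nothing claimed to exist) and the one-vertex WINDOW
  theorem `klB1gDominatesAtT0_of_signedDrift` ⇒ the tree's `KLB1gDominatesAtTP 0 a b γ`; the value-level shadow `rivalDrift_of_chartDrift`.
* §5 HQ1 (ii) as CONTROL: all-pairs growth/drift budgets ⇒ `MonotoneOn KlNotB1g.rivalMargin (Icc a b)` (`monotoneOn_rivalMargin_of_pairBudgets`;
  the growth input is the output shape of `KlConeOrder`, the drift input is this file's).

References: R. A. Horn, C. R. Johnson, *Matrix Analysis* (2nd ed., CUP 2012), Thm 4.3.1 (Weyl), Cor. 4.3.12 (monotonicity theorem), 4.3.P14;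
M. Plum, ZAMP 41 (1990) 205–226, doi:10.1007/bf00945108 (eigenvalue homotopy from a base problem — the nearest classical one-endpoint device;
there the homotopy is built monotone, here the physical family is not and the SIGN SPLIT is what is transported); F. Šimkovic, X.-W. Liu,
Y. Deng, E. Kozik, Phys. Rev. B 94 (2016) 085106, arXiv:1512.04271, §III (the float `t`–`t′` weak-coupling phase diagram is computed on a GRID,
`Δt′ = 0.025/0.05`, with nothing controlled between grid points); S. Raghu, S. A. Kivelson, D. J. Scalapino, Phys. Rev. B 81 (2010) 224505.
-/

noncomputable section

-- the tree's namespace convention repeats the summit name by design (D-0017)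
set_option linter.dupNamespace false

open Set
open Literature.MathematicalPhysics.QuantumLattice
open Summit.HubbardSuperconductivity.HubbardSuperconductivity.Theorems
open Summit.HubbardSuperconductivity.HubbardSuperconductivity.Theorems.KlNotB1g
open Summit.HubbardSuperconductivity.HubbardSuperconductivity.Theorems.KlVertexPropagation

namespace Summit.HubbardSuperconductivity.HubbardSuperconductivity.Theorems.KlSignedDrift

/-! ## §1  Abstract one-sided transport: infima of images move only by the negative part of the increment -/

/-- **Signed drift floor.**  If on the reference states `S` the form `q` dominates `q₁ − D` pointwise, then `inf q ≥ inf q₁ − D`.  The bound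
sees only how far `q` may DROP below `q₁`; any rise is free.  (Matrices: Weyl's lower inequality with `λ_min(B) ≥ −D`, Horn–Johnson Thm 4.3.1
(4.3.2b); with `B ⪰ 0` the monotonicity theorem, Cor. 4.3.12.) [folklore] -/
theorem sInf_image_sub_le_of_drift {ι : Type*} {S : Set ι} {q₁ q : ι → ℝ} {D : ℝ} (hS : S.Nonempty)
    (h₁ : BddBelow (q₁ '' S)) (h : ∀ ψ ∈ S, q₁ ψ - D ≤ q ψ) :
    sInf (q₁ '' S) - D ≤ sInf (q '' S) := by
  refine le_csInf (hS.image q) ?_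
  rintro _ ⟨ψ, hψ, rfl⟩
  have := csInf_le h₁ ⟨ψ, hψ, rfl⟩
  linarith [h ψ hψ]

/-- **Weyl's lower inequality in chart language**: `inf (q₁ + d) ≥ inf q₁ + inf d` on a common state set (`λ_min(A + B) ≥ λ_min(A) + λ_min(B)`,
Horn–Johnson Thm 4.3.1 (4.3.2b) with `i = j = 1`). [folklore] -/
theorem le_sInf_image_add {ι : Type*} {S : Set ι} {q₁ d : ι → ℝ} (hS : S.Nonempty)
    (h₁ : BddBelow (q₁ '' S)) (hd : BddBelow (d '' S)) :
    sInf (q₁ '' S) + sInf (d '' S) ≤ sInf ((fun ψ => q₁ ψ + d ψ) '' S) := by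
  refine le_csInf (hS.image _) ?_
  rintro _ ⟨ψ, hψ, rfl⟩
  have ha := csInf_le h₁ ⟨ψ, hψ, rfl⟩
  have hb := csInf_le hd ⟨ψ, hψ, rfl⟩
  linarith

/-- **Signed versus normed.**  The drift floor holds with `D` = the negative part of the BOTTOM of the increment `q − q₁` (not its norm): if
`inf (q − q₁) ≥ −D` then `inf q ≥ inf q₁ − D`.  On the `δ = ⅛` line the increments have operator norm up to `2.5` (the `A1g` block carries the
density-of-states growth) and bottoms `≥ −0.25` (floats) — the whole point of the leaf. [folklore] -/
theorem sInf_image_sub_le_of_increment {ι : Type*} {S : Set ι} {q₁ q : ι → ℝ} {D : ℝ} (hS : S.Nonempty)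
    (h₁ : BddBelow (q₁ '' S)) (hd : BddBelow ((fun ψ => q ψ - q₁ ψ) '' S))
    (hD : -D ≤ sInf ((fun ψ => q ψ - q₁ ψ) '' S)) :
    sInf (q₁ '' S) - D ≤ sInf (q '' S) := by
  have h := le_sInf_image_add hS h₁ hd
  have heq : (fun ψ => q₁ ψ + (q ψ - q₁ ψ)) = q := by
    funext ψ; ring
  rw [heq] at h
  linarith

/-! ## §2  The one-vertex segment theorem on a charted iso-density segment -/

/-- **Soundness of signed-drift propagation (one vertex).**  On a charted segment `[t₁, t₂]` (`KLChartedLine`, idea-3's datum) let `s` be the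
parameter of ONE certified vertex cell (an endpoint, or any point whose forms `q_s` are certified).  Suppose: (V) VERTEX RIVAL FLOORS
`F χ ≤ inf q_s χ` (`χ ≠ B1g`); (R) SIGNED DRIFT — for every `t′` of the segment and every rival reference state, `q_s χ ψ − D(t′, χ) ≤ q_{t′} χ ψ`
(a one-sided budget: only the drop counts); (C) TRANSPORTED CEILING — at every `t′` some `B1g` reference state has `q_{t′} B1g ψ ≤ C(t′)`
(Rayleigh–Ritz with an explicit state, e.g. the vertex's approximate ground state carried along the chart; its growth towards the van Hove level
is pure gain); (M) BUDGET `C(t′) + γ + D(t′, χ) ≤ F χ`; (G) `0 ≤ γ`, `G ≤ g` on the segment.  THEN `KLB1gDominatesOnLineTP δ t₁ t₂ (G·γ)`.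
Compared with `klB1gDominatesOnLine_of_chart`: one vertex instead of two, first-order one-sided budgets instead of second-order sag/bulge
budgets. [folklore] -/
theorem klB1gDominatesOnLine_of_signedDrift {δ t₁ t₂ : ℝ} (L : KLChartedLine δ t₁ t₂) (s : ℝ)
    {F : D4Irrep → ℝ} {D : ℝ → D4Irrep → ℝ} {C : ℝ → ℝ} {γ G : ℝ}
    (hF : ∀ χ, χ ≠ D4Irrep.B1g → F χ ≤ sInf (L.q s χ '' L.S χ))
    (hD : ∀ tp ∈ Icc t₁ t₂, ∀ χ, χ ≠ D4Irrep.B1g → ∀ ψ ∈ L.S χ, L.q s χ ψ - D tp χ ≤ L.q tp χ ψ)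
    (hC : ∀ tp ∈ Icc t₁ t₂, ∃ ψ ∈ L.S D4Irrep.B1g, L.q tp D4Irrep.B1g ψ ≤ C tp)
    (hm : ∀ tp ∈ Icc t₁ t₂, ∀ χ, χ ≠ D4Irrep.B1g → C tp + γ + D tp χ ≤ F χ)
    (hγ : 0 ≤ γ) (hG : ∀ tp ∈ Icc t₁ t₂, G ≤ L.g tp) :
    KLB1gDominatesOnLineTP δ t₁ t₂ (G * γ) := by
  intro tp htp χ hχ
  have hfloor : F χ - D tp χ ≤ sInf (L.q tp χ '' L.S χ) :=
    (sub_le_sub_right (hF χ hχ) _).trans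
      (sInf_image_sub_le_of_drift (L.S_nonempty χ) (L.q_bddBelow s χ) (hD tp htp χ hχ))
  obtain ⟨ψ, hψ, hψC⟩ := hC tp htp
  have hceil : sInf (L.q tp D4Irrep.B1g '' L.S D4Irrep.B1g) ≤ C tp :=
    sInf_image_le_of_testState (L.q_bddBelow tp D4Irrep.B1g) hψ hψC
  have hmarg : sInf (L.q tp D4Irrep.B1g '' L.S D4Irrep.B1g) + γ ≤ sInf (L.q tp χ '' L.S χ) := by
    linarith [hm tp htp χ hχ]
  have hg : 0 < L.g tp := L.g_pos tp htp
  rw [L.exact tp htp D4Irrep.B1g, L.exact tp htp χ]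
  have h1 : L.g tp * sInf (L.q tp D4Irrep.B1g '' L.S D4Irrep.B1g) + L.g tp * γ ≤
      L.g tp * sInf (L.q tp χ '' L.S χ) := by
    have := mul_le_mul_of_nonneg_left hmarg hg.le
    linarith [mul_add (L.g tp) (sInf (L.q tp D4Irrep.B1g '' L.S D4Irrep.B1g)) γ]
  have h2 : G * γ ≤ L.g tp * γ := mul_le_mul_of_nonneg_right (hG tp htp) hγ
  linarith

/-! ## §3  The derivative form: linear budgets, two endpoint checks (mean value theorem) -/

/-- **Linear budget from its two ends.**  An affine function of `u ∈ [0, ℓ]` lies below `F` iff it does at `u = 0` and `u = ℓ`. [folklore] -/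
theorem affine_budget_le {c γ r ℓ u F : ℝ} (hu₀ : 0 ≤ u) (hu : u ≤ ℓ) (h₀ : c + γ ≤ F) (hℓ : c + γ + r * ℓ ≤ F) :
    c + γ + r * u ≤ F := by
  rcases le_or_gt 0 r with hr | hr
  · nlinarith [mul_le_mul_of_nonneg_left hu hr]
  · nlinarith

/-- **Derivative form, vertex at the RIGHT end** (`s = t₂`; intended: the `Γ` segment `[−3/25, 0]` of the `δ = ⅛` line, vertex = the `t′ = 0`
TREE cell).  If along the chart every rival form has `t′`-derivative `≤ ω χ` on every rival reference state (so it DROPS at rate `≤ ω χ` going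
left), the transported `B1g` test value has derivative `≥ a` (its attraction GROWS at rate `≥ a` going left), and the linear budget
`C₂ + γ + (ω χ − a)(t₂ − t′) ≤ F χ` holds at both ends of the segment, then `KLB1gDominatesOnLineTP δ t₁ t₂ (G·γ)`.  The derivative floors /
growth rate are the ONE continuum input (interval `t′`-derivatives of the chart-family entries on rival sectors and on one test state; an ENGINE
item, not delivered here). [folklore] -/
theorem klB1gDominatesOnLine_of_derivBudget_right {δ t₁ t₂ : ℝ} (L : KLChartedLine δ t₁ t₂) (ht : t₁ ≤ t₂)
    {F ω : D4Irrep → ℝ} {ψ₀ : L.ι} {C₂ a γ G : ℝ}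
    (hF : ∀ χ, χ ≠ D4Irrep.B1g → F χ ≤ sInf (L.q t₂ χ '' L.S χ))
    (hcontR : ∀ χ, χ ≠ D4Irrep.B1g → ∀ ψ ∈ L.S χ, ContinuousOn (fun tp => L.q tp χ ψ) (Icc t₁ t₂))
    (hdiffR : ∀ χ, χ ≠ D4Irrep.B1g → ∀ ψ ∈ L.S χ, DifferentiableOn ℝ (fun tp => L.q tp χ ψ) (Ioo t₁ t₂))
    (hω : ∀ χ, χ ≠ D4Irrep.B1g → ∀ ψ ∈ L.S χ, ∀ tp ∈ Ioo t₁ t₂, deriv (fun tp => L.q tp χ ψ) tp ≤ ω χ)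
    (hψ₀ : ψ₀ ∈ L.S D4Irrep.B1g) (hC₂ : L.q t₂ D4Irrep.B1g ψ₀ ≤ C₂)
    (hcontB : ContinuousOn (fun tp => L.q tp D4Irrep.B1g ψ₀) (Icc t₁ t₂))
    (hdiffB : DifferentiableOn ℝ (fun tp => L.q tp D4Irrep.B1g ψ₀) (Ioo t₁ t₂))
    (ha : ∀ tp ∈ Ioo t₁ t₂, a ≤ deriv (fun tp => L.q tp D4Irrep.B1g ψ₀) tp)
    (hm₁ : ∀ χ, χ ≠ D4Irrep.B1g → C₂ + γ ≤ F χ)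
    (hm₂ : ∀ χ, χ ≠ D4Irrep.B1g → C₂ + γ + (ω χ - a) * (t₂ - t₁) ≤ F χ)
    (hγ : 0 ≤ γ) (hG : ∀ tp ∈ Icc t₁ t₂, G ≤ L.g tp) :
    KLB1gDominatesOnLineTP δ t₁ t₂ (G * γ) := by
  have hconv : Convex ℝ (Icc t₁ t₂) := convex_Icc t₁ t₂
  have hint : interior (Icc t₁ t₂) = Ioo t₁ t₂ := interior_Icc
  have ht₂ : t₂ ∈ Icc t₁ t₂ := right_mem_Icc.mpr ht
  refine klB1gDominatesOnLine_of_signedDrift L t₂ (D := fun tp χ => ω χ * (t₂ - tp))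
    (C := fun tp => C₂ - a * (t₂ - tp)) hF ?_ ?_ ?_ hγ hG
  · intro tp htp χ hχ ψ hψ
    have h := hconv.image_sub_le_mul_sub_of_deriv_le (hcontR χ hχ ψ hψ) (by rw [hint]; exact hdiffR χ hχ ψ hψ)
      (by rw [hint]; exact hω χ hχ ψ hψ) tp htp t₂ ht₂ htp.2
    linarith
  · intro tp htp
    refine ⟨ψ₀, hψ₀, ?_⟩
    have h := hconv.mul_sub_le_image_sub_of_le_deriv hcontB (by rw [hint]; exact hdiffB)
      (by rw [hint]; exact ha) tp htp t₂ ht₂ htp.2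
    linarith
  · intro tp htp χ hχ
    have h := affine_budget_le (r := ω χ - a) (sub_nonneg.mpr htp.2) (by linarith [htp.1] : t₂ - tp ≤ t₂ - t₁)
      (hm₁ χ hχ) (hm₂ χ hχ)
    linarith

/-- **Derivative form, vertex at the LEFT end** (`s = t₁`; intended: the `M` segment `[−3/10, −9/50]` of the `δ = ⅛` line, vertex = the
`t′ = −3/10` cell of kit job j320108).  Mirror image of the previous statement: rival derivatives `≥ −ω χ`, test-value derivative `≤ −a`,
linear budget `C₁ + γ + (ω χ − a)(t′ − t₁) ≤ F χ` at both ends. [folklore] -/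
theorem klB1gDominatesOnLine_of_derivBudget_left {δ t₁ t₂ : ℝ} (L : KLChartedLine δ t₁ t₂) (ht : t₁ ≤ t₂)
    {F ω : D4Irrep → ℝ} {ψ₀ : L.ι} {C₁ a γ G : ℝ}
    (hF : ∀ χ, χ ≠ D4Irrep.B1g → F χ ≤ sInf (L.q t₁ χ '' L.S χ))
    (hcontR : ∀ χ, χ ≠ D4Irrep.B1g → ∀ ψ ∈ L.S χ, ContinuousOn (fun tp => L.q tp χ ψ) (Icc t₁ t₂))
    (hdiffR : ∀ χ, χ ≠ D4Irrep.B1g → ∀ ψ ∈ L.S χ, DifferentiableOn ℝ (fun tp => L.q tp χ ψ) (Ioo t₁ t₂))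
    (hω : ∀ χ, χ ≠ D4Irrep.B1g → ∀ ψ ∈ L.S χ, ∀ tp ∈ Ioo t₁ t₂, -ω χ ≤ deriv (fun tp => L.q tp χ ψ) tp)
    (hψ₀ : ψ₀ ∈ L.S D4Irrep.B1g) (hC₁ : L.q t₁ D4Irrep.B1g ψ₀ ≤ C₁)
    (hcontB : ContinuousOn (fun tp => L.q tp D4Irrep.B1g ψ₀) (Icc t₁ t₂))
    (hdiffB : DifferentiableOn ℝ (fun tp => L.q tp D4Irrep.B1g ψ₀) (Ioo t₁ t₂))
    (ha : ∀ tp ∈ Ioo t₁ t₂, deriv (fun tp => L.q tp D4Irrep.B1g ψ₀) tp ≤ -a)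
    (hm₁ : ∀ χ, χ ≠ D4Irrep.B1g → C₁ + γ ≤ F χ)
    (hm₂ : ∀ χ, χ ≠ D4Irrep.B1g → C₁ + γ + (ω χ - a) * (t₂ - t₁) ≤ F χ)
    (hγ : 0 ≤ γ) (hG : ∀ tp ∈ Icc t₁ t₂, G ≤ L.g tp) :
    KLB1gDominatesOnLineTP δ t₁ t₂ (G * γ) := by
  have hconv : Convex ℝ (Icc t₁ t₂) := convex_Icc t₁ t₂
  have hint : interior (Icc t₁ t₂) = Ioo t₁ t₂ := interior_Icc
  have ht₁ : t₁ ∈ Icc t₁ t₂ := left_mem_Icc.mpr ht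
  refine klB1gDominatesOnLine_of_signedDrift L t₁ (D := fun tp χ => ω χ * (tp - t₁))
    (C := fun tp => C₁ - a * (tp - t₁)) hF ?_ ?_ ?_ hγ hG
  · intro tp htp χ hχ ψ hψ
    have h := hconv.mul_sub_le_image_sub_of_le_deriv (hcontR χ hχ ψ hψ) (by rw [hint]; exact hdiffR χ hχ ψ hψ)
      (by rw [hint]; exact hω χ hχ ψ hψ) t₁ ht₁ tp htp htp.1
    linarith
  · intro tp htp
    refine ⟨ψ₀, hψ₀, ?_⟩
    have h := hconv.image_sub_le_mul_sub_of_deriv_le hcontB (by rw [hint]; exact hdiffB)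
      (by rw [hint]; exact ha) t₁ ht₁ tp htp htp.1
    linarith
  · intro tp htp χ hχ
    have h := affine_budget_le (r := ω χ - a) (sub_nonneg.mpr htp.1) (by linarith [htp.2] : tp - t₁ ≤ t₂ - t₁)
      (hm₁ χ hχ) (hm₂ χ hχ)
    linarith

/-! ## §4  The `t′ = 0` doping axis: one far vertex carries a whole `μ`-window -/

/-- **A charted `μ`-window at `t′ = 0`** (raw gauge) — the datum an engine supplies before any transport along the doping axis: a reference
index type of states, per channel the admissible reference set, for each `μ` the pulled-back channel forms, and EXACTNESS on the window:
`channelInf ε₀ μ 1 χ = inf (q μ χ) (S χ)` (intended realisation: the isometry `ψ ↦ ψ·√w_μ` of `L²(σ_μ)` onto `L²(dθ)` of the polar chart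
about `Γ`).  A hypothesis-carrying structure: NOTHING is claimed to exist here. [folklore] -/
structure KLChartedAxis (a b : ℝ) where
  /-- reference index type of states -/
  ι : Type
  /-- admissible reference states of channel `χ` -/
  S : D4Irrep → Set ι
  /-- pulled-back channel form at chemical potential `μ` -/
  q : ℝ → D4Irrep → ι → ℝ
  S_nonempty : ∀ χ, (S χ).Nonempty
  q_bddBelow : ∀ μ χ, BddBelow (q μ χ '' S χ)
  exact : ∀ μ ∈ Icc a b, ∀ χ : D4Irrep, channelInf (squareDispersion 1 0) μ 1 χ = sInf (q μ χ '' S χ)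

/-- **One-vertex WINDOW theorem at `t′ = 0`.**  Vertex rival floors at ONE chemical potential `s` (intended: the far end of the window, the
largest doping, where the margin is smallest), signed drift budgets `D(μ, χ)` on the rival reference states, a transported `B1g` ceiling `C(μ)`
and the budget `C(μ) + γ + D(μ, χ) ≤ F χ` give the tree's window conclusion `KLB1gDominatesAtTP 0 a b γ`.  Floats (`M = 128`, exact elliptic
Lindhard function): from the vertex `δ = 0.35` (`μ = −0.885`, margin `0.038`) the signed minorant stays positive and increasing down to
`δ = 0.05` (`0.047 → 0.289`, `85 → 63 %` of the true margin); the normed one dies at the first `0.025`-step. [folklore] -/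
theorem klB1gDominatesAtT0_of_signedDrift {a b : ℝ} (X : KLChartedAxis a b) (s : ℝ)
    {F : D4Irrep → ℝ} {D : ℝ → D4Irrep → ℝ} {C : ℝ → ℝ} {γ : ℝ}
    (hF : ∀ χ, χ ≠ D4Irrep.B1g → F χ ≤ sInf (X.q s χ '' X.S χ))
    (hD : ∀ μ ∈ Icc a b, ∀ χ, χ ≠ D4Irrep.B1g → ∀ ψ ∈ X.S χ, X.q s χ ψ - D μ χ ≤ X.q μ χ ψ)
    (hC : ∀ μ ∈ Icc a b, ∃ ψ ∈ X.S D4Irrep.B1g, X.q μ D4Irrep.B1g ψ ≤ C μ)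
    (hm : ∀ μ ∈ Icc a b, ∀ χ, χ ≠ D4Irrep.B1g → C μ + γ + D μ χ ≤ F χ) :
    KLB1gDominatesAtTP 0 a b γ := by
  intro μ hμ χ hχ
  have hfloor : F χ - D μ χ ≤ sInf (X.q μ χ '' X.S χ) :=
    (sub_le_sub_right (hF χ hχ) _).trans
      (sInf_image_sub_le_of_drift (X.S_nonempty χ) (X.q_bddBelow s χ) (hD μ hμ χ hχ))
  obtain ⟨ψ, hψ, hψC⟩ := hC μ hμ
  have hceil : sInf (X.q μ D4Irrep.B1g '' X.S D4Irrep.B1g) ≤ C μ :=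
    sInf_image_le_of_testState (X.q_bddBelow μ D4Irrep.B1g) hψ hψC
  rw [X.exact μ hμ D4Irrep.B1g, X.exact μ hμ χ]
  linarith [hm μ hμ χ hχ]

/-- **The value-level shadow** (round 4's leaf (D)): a chart drift between two window points gives `KlPinchOrder.RivalDrift μa μb ω` —
`channelInf ε₀ μb 1 χ − ω ≤ channelInf ε₀ μa 1 χ` for the rivals `A2g, B2g, E`. [folklore] -/
theorem rivalDrift_of_chartDrift {a b : ℝ} (X : KLChartedAxis a b) {μa μb ω : ℝ} (hμa : μa ∈ Icc a b) (hμb : μb ∈ Icc a b)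
    (h : ∀ χ, IsRival χ → ∀ ψ ∈ X.S χ, X.q μb χ ψ - ω ≤ X.q μa χ ψ) :
    KlPinchOrder.RivalDrift μa μb ω := by
  intro χ hχ
  rw [X.exact μa hμa χ, X.exact μb hμb χ]
  exact sInf_image_sub_le_of_drift (X.S_nonempty χ) (X.q_bddBelow μb χ) (h χ hχ)

/-! ## §5  HQ1 (ii) as control: a monotone rival margin from all-pairs growth and drift budgets -/

/-- **Monotone margin from pair budgets.**  If for every ordered pair `μ ≤ μ′` of the window (B) the `B1g` bottom DEEPENS by at least
`A(μ, μ′)` (`inf q_{μ′} B1g + A ≤ inf q_μ B1g` — the output shape of the cone order, `KlConeOrder`, eigenvector-free), (R) every rival form drops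
by at most `D(μ, μ′, χ)` on its reference states, and (AD) `D ≤ A`, then the tree's rival margin `m(μ) = min(λ_A2g, λ_B2g, λ_E) − λ_B1g` is
MONOTONE (non-decreasing in `μ`, i.e. non-increasing in the doping) on the window — the continuum form of HQ1 (ii) at `t′ = 0`, decided by
budgets instead of a grid of two-sided words.  Floats: the stepwise budget `a − max_χ ω_χ` is positive on every `0.025`-step of `δ ∈ [0.05, 0.35]`
(`+0.085 … +1.91` per unit `μ`). [folklore] -/
theorem monotoneOn_rivalMargin_of_pairBudgets {a b : ℝ} (X : KLChartedAxis a b) {A : ℝ → ℝ → ℝ} {D : ℝ → ℝ → D4Irrep → ℝ}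
    (hB : ∀ μ ∈ Icc a b, ∀ μ' ∈ Icc a b, μ ≤ μ' →
      sInf (X.q μ' D4Irrep.B1g '' X.S D4Irrep.B1g) + A μ μ' ≤ sInf (X.q μ D4Irrep.B1g '' X.S D4Irrep.B1g))
    (hR : ∀ μ ∈ Icc a b, ∀ μ' ∈ Icc a b, μ ≤ μ' → ∀ χ, IsRival χ → ∀ ψ ∈ X.S χ, X.q μ χ ψ - D μ μ' χ ≤ X.q μ' χ ψ)
    (hAD : ∀ μ ∈ Icc a b, ∀ μ' ∈ Icc a b, μ ≤ μ' → ∀ χ, IsRival χ → D μ μ' χ ≤ A μ μ') :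
    MonotoneOn rivalMargin (Icc a b) := by
  intro μ hμ μ' hμ' hle
  have key : ∀ χ, IsRival χ →
      channelInf (squareDispersion 1 0) μ 1 χ - channelInf (squareDispersion 1 0) μ 1 D4Irrep.B1g ≤
        channelInf (squareDispersion 1 0) μ' 1 χ - channelInf (squareDispersion 1 0) μ' 1 D4Irrep.B1g := by
    intro χ hχ
    have hfl := sInf_image_sub_le_of_drift (X.S_nonempty χ) (X.q_bddBelow μ χ) (hR μ hμ μ' hμ' hle χ hχ)
    have hb := hB μ hμ μ' hμ' hle
    have had := hAD μ hμ μ' hμ' hle χ hχ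
    rw [X.exact μ hμ χ, X.exact μ hμ D4Irrep.B1g, X.exact μ' hμ' χ, X.exact μ' hμ' D4Irrep.B1g]
    linarith
  have hA := key D4Irrep.A2g ⟨by decide, by decide⟩
  have hB2 := key D4Irrep.B2g ⟨by decide, by decide⟩
  have hE := key D4Irrep.E ⟨by decide, by decide⟩
  have e1 : ∀ x y z c : ℝ, min (min x y) z - c = min (min (x - c) (y - c)) (z - c) := by
    intro x y z c
    simp only [min_sub_sub_right]
  unfold rivalMargin
  rw [e1, e1]
  exact min_le_min (min_le_min hA hB2) hE

/-- **One vertex ⇒ monotone minorant** (the control functional of the card, recorded as a remark lemma): under the hypotheses of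
`klB1gDominatesAtT0_of_signedDrift` with budgets written as `C μ = C_s − 𝒜 μ` and `𝒟 μ = max_χ D μ χ`, the function
`μ ↦ F₀ − C_s + 𝒜 μ − 𝒟 μ` (`F₀ = min_χ F χ`) minorises the margin; if `𝒜 − 𝒟` is monotone so is the minorant.  Here only the order fact used
downstream: a minorant that is `≥ γ` everywhere gives the window conclusion — which is `klB1gDominatesAtT0_of_signedDrift` itself; this lemma
records the pointwise minoration of each rival gap. [folklore] -/
theorem rivalGap_ge_of_signedDrift {a b : ℝ} (X : KLChartedAxis a b) (s : ℝ) {μ : ℝ} (hμ : μ ∈ Icc a b)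
    {χ : D4Irrep} {Fχ Dμ Cμ : ℝ}
    (hF : Fχ ≤ sInf (X.q s χ '' X.S χ)) (hD : ∀ ψ ∈ X.S χ, X.q s χ ψ - Dμ ≤ X.q μ χ ψ)
    (hC : ∃ ψ ∈ X.S D4Irrep.B1g, X.q μ D4Irrep.B1g ψ ≤ Cμ) :
    Fχ - Dμ - Cμ ≤ channelInf (squareDispersion 1 0) μ 1 χ - channelInf (squareDispersion 1 0) μ 1 D4Irrep.B1g := by
  have hfloor : Fχ - Dμ ≤ sInf (X.q μ χ '' X.S χ) :=
    (sub_le_sub_right hF _).trans (sInf_image_sub_le_of_drift (X.S_nonempty χ) (X.q_bddBelow s χ) hD)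
  obtain ⟨ψ, hψ, hψC⟩ := hC
  have hceil : sInf (X.q μ D4Irrep.B1g '' X.S D4Irrep.B1g) ≤ Cμ :=
    sInf_image_le_of_testState (X.q_bddBelow μ D4Irrep.B1g) hψ hψC
  rw [X.exact μ hμ χ, X.exact μ hμ D4Irrep.B1g]
  linarith

end Summit.HubbardSuperconductivity.HubbardSuperconductivity.Theorems.KlSignedDrift

end
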